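/-
Copyright: the b2b-balaban cell (near-miss cell 7), T⁴-continuum CRUX team (coordinator ruling e34b3e0c item (2)),
row-NE7b OWNER lineage `t4-ne7b-p1` (gen 104). Released under the licence of the surrounding project.
-/
import Mathlib.MeasureTheory.Integral.Marginal
import Summits.QuantumFields.BalabanUV.T4Continuum.Spine.NE7b.DressingSupFloor

/-!
# THE BARE WILSON PARTITION FUNCTION IS AT MOST A POWER OF THE SINGLE-PLAQUETTE HAAR MASS — the last third of the
# owner's located finding F-ne7bp1-g103-2 (row NE7b, memo `t4/b2b-balaban-t4-ne7b-p1/g103/F-RHO-TOWER-g103.md`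
# §1 (c)), in kernel, part 1 of 2

Cell `pub-balaban`, sub-cell `t4`, spine estimate NE7b (`T4WeightBudget.RelWeightBound`, the cell's OWN estimate — NOT
PRINTED, NOT PROVED).  Crux-route work under `Spine/NE7b/`; no `T4Continuum/Support` leaf typed, no `Prop` of Bałaban's
minted, no `[cite:]` tag; zero `sorry`.  Imports Mathlib's marginal integrals (`MeasureTheory.lmarginal`) and the sibling
`DressingSupFloor` (§§1–4 of the finding: the END's sup letter `B` of the dressed initial density satisfies
`exp(−|t|B_obs − ē n₁ − BA∞)·c₀ ≤ Z_K`, `DressingSupFloor.partitionFn_ge_of_letters`).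

WHAT IS PROVED ([folklore]; Haar independence on the finite product `fieldMeasure = Measure.pi haar`).
* §1 the single-plaquette Boltzmann factor `φ_β(V) = exp(−β(1 − Re tr V))` and its Haar mass
  `linkMass β = ∫_G φ_β dV` (`0 ≤ linkMass β ≤ 1` for `β ≥ 0`, antitone in `β`; `linkMassE` its `ℝ≥0∞` twin).
* §2 `boltzmann_eq_prod`: `e^{−βA(U)} = ∏_p φ_β(U(∂p))`; for `β ≥ 0` every factor is `≤ 1`, so the weight is bounded by
  the product over ANY sub-family of plaquettes (`boltzmann_le_prod`).
* §3 a LINK-DISJOINT PLAQUETTE FAMILY with PIVOT LINKS: the plaquettes `p_x = ⟨x, e₀, e₁⟩` of the `(0,1)`-plane at the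
  sites `x` with `x₁ = 0`; the first link `⟨x, e₀⟩` of `p_x` («pivot») is a link of no other `p_{x'}` of the family and
  of none of the three companion links of `p_x` itself (`plaqHol_update_pivot_self ∕ _of_ne`).
* §4 **`lmarginal_famFun`**: integrating out the pivot links one at a time (Mathlib `lmarginal_insert'`), right
  invariance of Haar (`lintegral_mul_right_eq_self`) turns each factor `∫ φ_β(V · W) dV` into `linkMass β`
  whatever the companion holonomy `W`: the marginal over the pivots of `∏_{x ∈ A} φ_β(U(∂p_x))` is the CONSTANT
  `linkMassE β ^ #A`.
* §5 **`partitionFn_le_linkMass_pow`**: `Z(P, β) ≤ linkMass β ^ #famSites` (`β ≥ 0`, any `Params` with `d ≥ 2`).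
The sequel `…NE7b.BarePartitionFnNoFloor` bounds `#famSites ≥ sitesPerDir`, specialises to Bałaban's `K`-th torus
(`Z_K ≤ linkMass β ^ (2·L^{m+K})`) and
closes F-ne7bp1-g103-2: with `DressingSupFloor.partitionFn_ge_of_letters`, the END's letter family {`hBρ`, K-uniform
`hBA`, `floor`, `sites`, (B)'s `Cor3With`} is unsatisfiable at the intended dressing in any coupling window where the
single-plaquette mass stays `≤ θ < 1`.

HONEST REMARKS.  (i) Whether `linkMass β < 1` is a property of the group and its trace: the abstract interface
`GaugeGroup` allows `reTr ≡ 1` (then `Z = 1` and nothing decays); for a closed non-trivial subgroup of `U(N)` with the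
normalised trace it holds for `β > 0` — NOT computed here.  (ii) Nothing of Bałaban's is asserted, valued or discharged.
NE7b NOT PRINTED ∕ NOT PROVED; spine PROVED 0∕9; rung (B)+1 on a FINITE torus — NOT infinite volume, NOT the mass gap,
NOT Clay.
HONEST DEPENDENCY: continuum YM on T⁴ ⇐ BetaPertH ∧ nine spine estimates (0/9 proved); BetaPertH ⇐ (D1) ∧ (D4) ∧
CAP+tail; G-an2-4 gates asym, D1 and NE2/3/4.  This file changes none of it. -/

set_option autoImplicit false

open MeasureTheory
open scoped ENNReal
open Literature.MathematicalPhysics.QuantumFieldTheory.Balaban1983to89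
open Literature.MathematicalPhysics.QuantumFieldTheory.Balaban1983to89.Missing
open Literature.MathematicalPhysics.QuantumFieldTheory.Balaban1983to89.T4Continuum
open Literature.MathematicalPhysics.QuantumFieldTheory.Balaban1983to89.T4StabilitySocket

namespace Summit.QuantumFields.BalabanUV.T4Continuum.NE7b.BarePartitionFnDecay

noncomputable section

variable {G : Type*} [GaugeGroup G] [MeasurableSpace G] [HaarData G]

/-! ## §1 The single-plaquette Boltzmann factor and its Haar mass -/

/-- The single-plaquette Boltzmann factor `φ_β(V) = exp(−β (1 − Re tr V))`. [folklore] -/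
def plaqFactor (β : ℝ) (V : G) : ℝ := Real.exp (-β * (1 - reTr V))

omit [MeasurableSpace G] [HaarData G] in
/-- `φ_β > 0`. [folklore] -/
theorem plaqFactor_pos (β : ℝ) (V : G) : 0 < plaqFactor β V := Real.exp_pos _

omit [MeasurableSpace G] [HaarData G] in
/-- `φ_β ≤ 1` for `β ≥ 0` (`Re tr ≤ 1`). [folklore] -/
theorem plaqFactor_le_one {β : ℝ} (hβ : 0 ≤ β) (V : G) : plaqFactor β V ≤ 1 :=
  Real.exp_le_one_iff.mpr
    (mul_nonpos_of_nonpos_of_nonneg (neg_nonpos.mpr hβ) (sub_nonneg.mpr (GaugeGroup.reTr_le_one V)))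

omit [MeasurableSpace G] [HaarData G] in
/-- `φ_β` is antitone in `β`. [folklore] -/
theorem plaqFactor_antitone {β β' : ℝ} (h : β ≤ β') (V : G) : plaqFactor β' V ≤ plaqFactor β V := by
  unfold plaqFactor
  have h0 : 0 ≤ 1 - reTr V := sub_nonneg.mpr (GaugeGroup.reTr_le_one V)
  exact Real.exp_le_exp.mpr (by nlinarith)

/-- The Haar mass of one plaquette factor, `linkMass β = ∫_G exp(−β(1 − Re tr V)) dV`. [folklore] -/
def linkMass (β : ℝ) : ℝ := ∫ V, plaqFactor β V ∂(HaarData.haar : Measure G)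

/-- The same mass as an extended non-negative real, `∫⁻ ofReal φ_β dV`. [folklore] -/
def linkMassE (β : ℝ) : ℝ≥0∞ := ∫⁻ V, ENNReal.ofReal (plaqFactor β V) ∂(HaarData.haar : Measure G)

/-- `linkMass β ≥ 0`. [folklore] -/
theorem linkMass_nonneg (β : ℝ) : 0 ≤ linkMass (G := G) β :=
  integral_nonneg fun V => (plaqFactor_pos β V).le

/-- `linkMassE β ≤ 1` for `β ≥ 0` (Haar is a probability measure). [folklore] -/
theorem linkMassE_le_one {β : ℝ} (hβ : 0 ≤ β) : linkMassE (G := G) β ≤ 1 := by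
  haveI : IsProbabilityMeasure (HaarData.haar (G := G)) := HaarData.isProb
  calc linkMassE (G := G) β ≤ ∫⁻ _, 1 ∂(HaarData.haar : Measure G) :=
        lintegral_mono fun V => ENNReal.ofReal_le_one.mpr (plaqFactor_le_one hβ V)
    _ = 1 := by rw [lintegral_one, measure_univ]

/-- Haar data is right invariant (instance form of `HaarData.map_mul_right`). [folklore] -/
instance haar_isMulRightInvariant : (HaarData.haar : Measure G).IsMulRightInvariant :=
  ⟨HaarData.map_mul_right⟩

variable [RegularGaugeGroup G]

omit [HaarData G] in
/-- `φ_β` is measurable (measurable `Re tr`). [folklore] -/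
theorem measurable_plaqFactor (β : ℝ) : Measurable (plaqFactor (G := G) β) :=
  (measurable_const.mul (measurable_const.sub RegularGaugeGroup.measurable_reTr)).exp

omit [MeasurableSpace G] [HaarData G] [RegularGaugeGroup G] in
/-- The crude bound `φ_β(V) ≤ exp(|β| · |1 − Re tr V|)`. [folklore] -/
theorem plaqFactor_le_exp_abs (β : ℝ) (V : G) : plaqFactor β V ≤ Real.exp (|β| * |1 - reTr V|) := by
  unfold plaqFactor
  refine Real.exp_le_exp.mpr ?_
  calc -β * (1 - reTr V) ≤ |-β * (1 - reTr V)| := le_abs_self _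
    _ = |β| * |1 - reTr V| := by rw [abs_mul, abs_neg]

/-- `φ_β` is Haar integrable (bounded and measurable on a probability space). [folklore] -/
theorem integrable_plaqFactor (β : ℝ) : Integrable (plaqFactor (G := G) β) (HaarData.haar : Measure G) := by
  haveI : IsProbabilityMeasure (HaarData.haar (G := G)) := HaarData.isProb
  refine (integrable_const (Real.exp (|β| * 2))).mono' (measurable_plaqFactor β).aestronglyMeasurable
    (Filter.Eventually.of_forall fun V => ?_)
  rw [Real.norm_eq_abs, abs_of_pos (plaqFactor_pos β V)]
  refine (plaqFactor_le_exp_abs β V).trans (Real.exp_le_exp.mpr ?_)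
  have h1 : |1 - reTr V| ≤ 2 := by
    obtain ⟨h0, h2⟩ := RegularGaugeGroup.one_sub_reTr_mem_Icc V
    rw [abs_of_nonneg h0]; exact h2
  exact mul_le_mul_of_nonneg_left h1 (abs_nonneg β)

/-- `linkMassE β = ofReal (linkMass β)`. [folklore] -/
theorem linkMassE_eq_ofReal (β : ℝ) : linkMassE (G := G) β = ENNReal.ofReal (linkMass (G := G) β) :=
  (ofReal_integral_eq_lintegral_ofReal (integrable_plaqFactor β)
    (Filter.Eventually.of_forall fun V => (plaqFactor_pos β V).le)).symm

/-- `linkMassE β < ∞`. [folklore] -/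
theorem linkMassE_ne_top (β : ℝ) : linkMassE (G := G) β ≠ ∞ := by
  rw [linkMassE_eq_ofReal]; exact ENNReal.ofReal_ne_top

/-- `linkMass β ≤ 1` for `β ≥ 0`. [folklore] -/
theorem linkMass_le_one {β : ℝ} (hβ : 0 ≤ β) : linkMass (G := G) β ≤ 1 := by
  have h := linkMassE_le_one (G := G) hβ
  rw [linkMassE_eq_ofReal] at h
  have h' : ENNReal.ofReal (linkMass (G := G) β) ≤ ENNReal.ofReal 1 := by rwa [ENNReal.ofReal_one]
  exact (ENNReal.ofReal_le_ofReal_iff zero_le_one).mp h'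

/-- `linkMass` is antitone in `β`. [folklore] -/
theorem linkMass_antitone {β β' : ℝ} (h : β ≤ β') : linkMass (G := G) β' ≤ linkMass (G := G) β :=
  integral_mono (integrable_plaqFactor β') (integrable_plaqFactor β) fun V => plaqFactor_antitone h V

/-! ## §2 The Boltzmann weight is the product of the plaquette factors -/

omit [MeasurableSpace G] [HaarData G] [RegularGaugeGroup G] in
/-- `e^{−βA(U)} = ∏_p φ_β(U(∂p))`. [folklore] -/
theorem boltzmann_eq_prod (P : Params) (β : ℝ) (U : GaugeField P 0 G) :
    boltzmann P β U = ∏ p : Plaq P 0, plaqFactor β (GaugeField.plaqHol U p) := by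
  unfold boltzmann wilsonAction4 wilsonAction plaqFactor
  rw [← Real.exp_sum, Finset.mul_sum]
  simp only [one_mul]

omit [MeasurableSpace G] [HaarData G] [RegularGaugeGroup G] in
/-- For `β ≥ 0` the weight is bounded by the product over ANY sub-family of plaquettes. [folklore] -/
theorem boltzmann_le_prod (P : Params) {β : ℝ} (hβ : 0 ≤ β) (s : Finset (Plaq P 0)) (U : GaugeField P 0 G) :
    boltzmann P β U ≤ ∏ p ∈ s, plaqFactor β (GaugeField.plaqHol U p) := by
  classical
  rw [boltzmann_eq_prod, ← Finset.prod_mul_prod_compl s]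
  exact mul_le_of_le_one_right (Finset.prod_nonneg fun p _ => (plaqFactor_pos β _).le)
    (Finset.prod_le_one (fun p _ => (plaqFactor_pos β _).le) fun p _ => plaqFactor_le_one hβ _)

/-! ## §3 A link-disjoint plaquette family with pivot links -/

section Family

variable (P : Params) (hd : 2 ≤ P.d)

omit [MeasurableSpace G] [HaarData G] [RegularGaugeGroup G]

/-- The direction `e₀`. [folklore] -/
def dirA : Fin P.d := ⟨0, by omega⟩
/-- The direction `e₁`. [folklore] -/
def dirB : Fin P.d := ⟨1, by omega⟩

/-- `e₀ < e₁`. [folklore] -/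
theorem dirA_lt_dirB : dirA P hd < dirB P hd := Fin.mk_lt_mk.mpr Nat.zero_lt_one
/-- `e₀ ≠ e₁`. [folklore] -/
theorem dirA_ne_dirB : dirA P hd ≠ dirB P hd := Fin.ne_of_lt (dirA_lt_dirB P hd)

/-- The family's plaquette at `x`: `p_x = ⟨x, e₀, e₁⟩` in the `(0,1)`-plane. [folklore] -/
def famPlaq (x : Site P 0) : Plaq P 0 := ⟨x, dirA P hd, dirB P hd, dirA_lt_dirB P hd⟩

/-- The pivot link `⟨x, e₀⟩` of `p_x` (its first link). [folklore] -/
def pivot (x : Site P 0) : PBond P 0 := ⟨x, dirA P hd⟩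

/-- The family's sites: those with `x₁ = 0`. [folklore] -/
def famSites : Finset (Site P 0) := Finset.univ.filter fun x => x (dirB P hd) = 0

/-- The holonomy of the three companion links of `p_x`: `U(x+e₀,e₁) U(x+e₁,e₀)⁻¹ U(x,e₁)⁻¹`. [folklore] -/
def coHol (U : GaugeField P 0 G) (x : Site P 0) : G :=
  U ⟨x.shift (dirA P hd), dirB P hd⟩ * (U ⟨x.shift (dirB P hd), dirA P hd⟩)⁻¹ * (U ⟨x, dirB P hd⟩)⁻¹

/-- `pivot` is injective. [folklore] -/
theorem pivot_injective : Function.Injective (pivot P hd) := by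
  intro x y h
  have := congrArg PBond.src h
  exact this

/-- `famPlaq` is injective. [folklore] -/
theorem famPlaq_injective : Function.Injective (famPlaq P hd) := by
  intro x y h
  have := congrArg Plaq.src h
  exact this

/-- `U(∂p_x) = U(pivot x) · coHol U x`. [folklore] -/
theorem plaqHol_famPlaq (U : GaugeField P 0 G) (x : Site P 0) :
    GaugeField.plaqHol U (famPlaq P hd x) = U (pivot P hd x) * coHol P hd U x := by
  simp only [GaugeField.plaqHol, famPlaq, pivot, coHol, mul_assoc]

/-- The finest torus has more than one site per direction (`2·L^{m+K} ≥ 2`). [folklore] -/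
theorem one_lt_sitesPerDir_zero : 1 < P.sitesPerDir 0 := by
  unfold Params.sitesPerDir
  have hL : 1 ≤ P.L ^ (P.m + P.K - 0) := Nat.one_le_pow _ _ P.L_pos
  omega

/-- `1 ≠ 0` among the coordinates of the finest torus. [folklore] -/
theorem one_ne_zero_coord : (1 : ZMod (P.sitesPerDir 0)) ≠ 0 := by
  haveI : Fact (1 < P.sitesPerDir 0) := ⟨one_lt_sitesPerDir_zero P⟩
  exact one_ne_zero

/-- A site of the family shifted by `e₁` is NOT the source of any pivot of the family. [folklore] -/
theorem shift_dirB_ne {x x₀ : Site P 0} (hx : x (dirB P hd) = 0) (hx₀ : x₀ (dirB P hd) = 0) :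
    x.shift (dirB P hd) ≠ x₀ := by
  intro h
  have h1 : (x.shift (dirB P hd)) (dirB P hd) = x (dirB P hd) + 1 := by
    simp [Site.shift]
  rw [h, hx₀, hx, zero_add] at h1
  exact one_ne_zero_coord P h1.symm

variable [DecidableEq (PBond P 0)]

/-- The companion holonomy of a family plaquette does not see any pivot link of the family. [folklore] -/
theorem coHol_update_pivot (U : GaugeField P 0 G) (V : G) {x x₀ : Site P 0} (hx : x (dirB P hd) = 0)
    (hx₀ : x₀ (dirB P hd) = 0) :
    coHol P hd (Function.update U (pivot P hd x₀) V) x = coHol P hd U x := by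
  unfold coHol
  have h1 : (⟨x.shift (dirA P hd), dirB P hd⟩ : PBond P 0) ≠ pivot P hd x₀ :=
    fun h => dirA_ne_dirB P hd (congrArg PBond.dir h).symm
  have h2 : (⟨x.shift (dirB P hd), dirA P hd⟩ : PBond P 0) ≠ pivot P hd x₀ :=
    fun h => shift_dirB_ne P hd hx hx₀ (congrArg PBond.src h)
  have h3 : (⟨x, dirB P hd⟩ : PBond P 0) ≠ pivot P hd x₀ :=
    fun h => dirA_ne_dirB P hd (congrArg PBond.dir h).symm
  rw [Function.update_of_ne h1, Function.update_of_ne h2, Function.update_of_ne h3]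

/-- Replacing the pivot variable of `p_{x₀}` by `V`: the holonomy of `p_{x₀}` becomes `V · coHol U x₀`. [folklore] -/
theorem plaqHol_update_pivot_self (U : GaugeField P 0 G) (V : G) {x₀ : Site P 0} (hx₀ : x₀ (dirB P hd) = 0) :
    GaugeField.plaqHol (Function.update U (pivot P hd x₀) V) (famPlaq P hd x₀) = V * coHol P hd U x₀ := by
  rw [plaqHol_famPlaq, coHol_update_pivot P hd U V hx₀ hx₀, Function.update_self]

/-- … while the holonomy of every OTHER family plaquette is unchanged. [folklore] -/
theorem plaqHol_update_pivot_of_ne (U : GaugeField P 0 G) (V : G) {x x₀ : Site P 0} (hx : x (dirB P hd) = 0)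
    (hx₀ : x₀ (dirB P hd) = 0) (hne : x ≠ x₀) :
    GaugeField.plaqHol (Function.update U (pivot P hd x₀) V) (famPlaq P hd x) =
      GaugeField.plaqHol U (famPlaq P hd x) := by
  rw [plaqHol_famPlaq, plaqHol_famPlaq, coHol_update_pivot P hd U V hx hx₀,
    Function.update_of_ne (fun h => hne (pivot_injective P hd h))]

end Family

/-! ## §4 Integrating out the pivot links: the marginal of the family product is a constant -/

section Marginal

variable (P : Params) (hd : 2 ≤ P.d)

/-- The family product `∏_{x ∈ A} ofReal φ_β(U(∂p_x))` as an `ℝ≥0∞`-valued function of the configuration. [folklore] -/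
def famFun (β : ℝ) (A : Finset (Site P 0)) (U : GaugeField P 0 G) : ℝ≥0∞ :=
  ∏ x ∈ A, ENNReal.ofReal (plaqFactor β (GaugeField.plaqHol U (famPlaq P hd x)))

omit [HaarData G] in
/-- `famFun` is measurable. [folklore] -/
theorem measurable_famFun (β : ℝ) (A : Finset (Site P 0)) : Measurable (famFun (G := G) P hd β A) := by
  unfold famFun
  refine Finset.measurable_prod A fun x _ => ?_
  exact ((measurable_plaqFactor β).comp (measurable_plaqHol _)).ennreal_ofReal

/-- One Haar integration of a plaquette factor against an arbitrary right companion gives `linkMassE β`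
(right invariance of Haar). [folklore] -/
theorem lintegral_plaqFactor_mul_right (β : ℝ) (W : G) :
    ∫⁻ V, ENNReal.ofReal (plaqFactor β (V * W)) ∂(HaarData.haar : Measure G) = linkMassE (G := G) β :=
  lintegral_mul_right_eq_self (μ := (HaarData.haar : Measure G))
    (fun V => ENNReal.ofReal (plaqFactor β V)) W

variable [DecidableEq (PBond P 0)]

/-- **THE MARGINAL OVER THE PIVOT LINKS OF THE FAMILY PRODUCT IS `linkMassE β ^ #A`** (`A ⊆ famSites`): peel the pivots
one at a time (`lmarginal_insert'`); Haar right invariance gives the factor `linkMassE β` at each. [folklore] -/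
theorem lmarginal_famFun (β : ℝ) :
    ∀ A : Finset (Site P 0), A ⊆ famSites P hd →
      (∫⋯∫⁻_(A.image (pivot P hd)), famFun P hd β A ∂(fun _ : PBond P 0 => (HaarData.haar : Measure G))) =
        fun _ => linkMassE (G := G) β ^ A.card := by
  haveI : IsProbabilityMeasure (HaarData.haar (G := G)) := HaarData.isProb
  intro A
  induction A using Finset.induction_on with
  | empty =>
    intro _
    ext U
    simp [famFun]
  | insert x₀ A' hx₀ ih =>
    intro hsub
    have hx₀fam : x₀ (dirB P hd) = 0 := (Finset.mem_filter.mp (hsub (Finset.mem_insert_self _ _))).2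
    have hsub' : A' ⊆ famSites P hd := fun x hx => hsub (Finset.mem_insert_of_mem hx)
    have hnot : pivot P hd x₀ ∉ A'.image (pivot P hd) := by
      rw [Finset.mem_image]
      rintro ⟨x, hx, hxe⟩
      exact hx₀ (pivot_injective P hd hxe ▸ hx)
    rw [Finset.image_insert, lmarginal_insert' _ (measurable_famFun P hd β _) hnot]
    have hinner : (fun U : PBond P 0 → G => ∫⁻ V, famFun P hd β (insert x₀ A')
        (Function.update U (pivot P hd x₀) V) ∂(HaarData.haar : Measure G)) =
        fun U => linkMassE (G := G) β * famFun P hd β A' U := by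
      ext U
      have hrew : ∀ V : G, famFun P hd β (insert x₀ A') (Function.update U (pivot P hd x₀) V) =
          ENNReal.ofReal (plaqFactor β (V * coHol P hd U x₀)) * famFun P hd β A' U := by
        intro V
        unfold famFun
        rw [Finset.prod_insert hx₀, plaqHol_update_pivot_self P hd U V hx₀fam]
        congr 1
        refine Finset.prod_congr rfl fun x hx => ?_
        have hxfam : x (dirB P hd) = 0 := (Finset.mem_filter.mp (hsub' hx)).2
        have hne : x ≠ x₀ := fun h => hx₀ (h ▸ hx)
        rw [plaqHol_update_pivot_of_ne P hd U V hxfam hx₀fam hne]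
      simp_rw [hrew]
      have hmeas : Measurable fun V : G => ENNReal.ofReal (plaqFactor β (V * coHol P hd U x₀)) :=
        ((measurable_plaqFactor β).comp (measurable_id.mul_const _)).ennreal_ofReal
      rw [lintegral_mul_const _ hmeas, lintegral_plaqFactor_mul_right]
    rw [hinner]
    ext U
    have hih := congrFun (ih hsub') U
    simp only [lmarginal] at hih ⊢
    rw [lintegral_const_mul' _ _ (linkMassE_ne_top β), hih, Finset.card_insert_of_notMem hx₀, pow_succ,
      mul_comm]

end Marginal

/-! ## §5 The bare partition function is at most `linkMass β ^ #famSites ≤ linkMass β ^ (sites per direction)` -/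

section Assembly

variable (P : Params) (hd : 2 ≤ P.d)

/-- `∫ ∏_{x ∈ famSites} φ_β(U(∂p_x)) dU ≤ linkMassE β ^ #famSites`: the marginal over the pivots is that constant (§4),
the remaining Haar integrations are over probability measures. [folklore] -/
theorem lintegral_famFun_le [DecidableEq (PBond P 0)] (β : ℝ) :
    ∫⁻ U, famFun P hd β (famSites P hd) U ∂fieldMeasure P 0 G ≤ linkMassE (G := G) β ^ (famSites P hd).card := by
  haveI : IsProbabilityMeasure (HaarData.haar (G := G)) := HaarData.isProb
  have hconst : (∫⋯∫⁻_((famSites P hd).image (pivot P hd)),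
      (fun _ => linkMassE (G := G) β ^ (famSites P hd).card)
        ∂(fun _ : PBond P 0 => (HaarData.haar : Measure G))) =
      fun _ => linkMassE (G := G) β ^ (famSites P hd).card := by
    ext U
    simp only [lmarginal, lintegral_const, measure_univ, mul_one]
  have hfg := ((lmarginal_famFun P hd β (famSites P hd) subset_rfl).trans hconst.symm).le
  have h := lintegral_le_of_lmarginal_le (μ := fun _ : PBond P 0 => (HaarData.haar : Measure G))
    ((famSites P hd).image (pivot P hd)) (measurable_famFun P hd β (famSites P hd)) measurable_const hfg
  have hpi : fieldMeasure P 0 G = Measure.pi fun _ : PBond P 0 => (HaarData.haar : Measure G) := rfl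
  rw [hpi]
  refine h.trans (le_of_eq ?_)
  rw [lintegral_const, measure_univ, mul_one]

/-- `∫ ofReal e^{−βA} dU ≤ linkMassE β ^ #famSites` for `β ≥ 0`. [folklore] -/
theorem lintegral_boltzmann_le {β : ℝ} (hβ : 0 ≤ β) :
    ∫⁻ U, ENNReal.ofReal (boltzmann P β U) ∂fieldMeasure P 0 G ≤ linkMassE (G := G) β ^ (famSites P hd).card := by
  classical
  refine le_trans (lintegral_mono fun U => ?_) (lintegral_famFun_le P hd β)
  have hle : boltzmann P β U ≤ ∏ x ∈ famSites P hd, plaqFactor β (GaugeField.plaqHol U (famPlaq P hd x)) := by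
    have h := boltzmann_le_prod P hβ ((famSites P hd).image (famPlaq P hd)) U
    rwa [Finset.prod_image (fun x _ y _ h => famPlaq_injective P hd h)] at h
  calc ENNReal.ofReal (boltzmann P β U)
      ≤ ENNReal.ofReal (∏ x ∈ famSites P hd, plaqFactor β (GaugeField.plaqHol U (famPlaq P hd x))) :=
        ENNReal.ofReal_le_ofReal hle
    _ = famFun P hd β (famSites P hd) U := by
        rw [ENNReal.ofReal_prod_of_nonneg fun x _ => (plaqFactor_pos β _).le]; rfl

/-- **`Z(P, β) ≤ linkMass β ^ #famSites`** for `β ≥ 0` and any `Params` with `d ≥ 2`. [folklore] -/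
theorem partitionFn_le_linkMass_pow {β : ℝ} (hβ : 0 ≤ β) :
    partitionFn (G := G) P β ≤ linkMass (G := G) β ^ (famSites P hd).card := by
  have hint := integrable_boltzmann (G := G) RegularGaugeGroup.measurable_reTr P hβ
  have h1 : ENNReal.ofReal (partitionFn (G := G) P β) =
      ∫⁻ U, ENNReal.ofReal (boltzmann P β U) ∂fieldMeasure P 0 G :=
    ofReal_integral_eq_lintegral_ofReal hint (Filter.Eventually.of_forall fun U => (boltzmann_pos P β U).le)
  have h2 : ENNReal.ofReal (partitionFn (G := G) P β) ≤
      ENNReal.ofReal (linkMass (G := G) β ^ (famSites P hd).card) := by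
    rw [h1, ENNReal.ofReal_pow (linkMass_nonneg β), ← linkMassE_eq_ofReal]
    exact lintegral_boltzmann_le P hd hβ
  exact (ENNReal.ofReal_le_ofReal_iff (pow_nonneg (linkMass_nonneg β) _)).mp h2

end Assembly

end

end Summit.QuantumFields.BalabanUV.T4Continuum.NE7b.BarePartitionFnDecay
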